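import Summits.QuantumFields.YangMills.Theorems.IR.ShellMaxCorrMarkov

/-!
# Crux `IR` (item stmt-QuantumFields-19354) — line «maximal correlation at one physical thickness»:
the DOUBLING LAW `Ψ(2s+1) ≤ Ψ(s)²` and its iteration

Helper module for item `stmt-QuantumFields-19354` (`--supports … --as helper`; it closes nothing; lead prover
ym-ir-line-mxc-p1).  Second input of the registered stub `ShellMaxCorr.stub_shellEngine : ShellEngine`
(`Theorems/IR/ShellMaxCorrDefs.lean`), on top of the ball Markov property `exists_layer_version`
(`Theorems/IR/ShellMaxCorrMarkov.lean`).

* §3 covariance bookkeeping for bounded measurable observables under a probability measure (Mathlib `cov[·,·;μ]`,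
  `Var[·;μ]`): `Cov(f,g) = ∫ f g − ∫ f ∫ g`, `Var f = Cov(f,f)`.
* §4 `shellCert_double` — the annulus-gluing transfer: if the shell maximal correlation of the torus Wilson state at thickness
  `s` is `≤ θ` for every inner radius (`ShellCert ρ β S s θ`), then at thickness `2s+1` it is `≤ θ²`.  Proof (Hilbert-space
  product bound across the Markov layer at radius `R+s+1`): with the layer version `g'` of `g`, `Cov(f,g) = Cov(f,g')`,
  `Var g' = Cov(g',g)`, and both pairs `(f,g')`, `(g',g)` are `s`-separated, so `σ(g') ≤ θ σ(g)` and
  `|Cov(f,g)| ≤ θ σ(f) σ(g') ≤ θ² σ(f) σ(g)`.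
* §5 monotonicity of the certificate in thickness and constant; `shellCert_iterate` (`Ψ(2^k (s+1) − 1) ≤ θ^(2^k)`),
  `shellCert_of_le` (every thickness `t ≥ s`, exponent `2^⌊log₂((t+1)/(s+1))⌋`) and the arithmetic
  `div_le_two_pow_log` (`(t+1)/(2(s+1)) ≤ 2^⌊log₂((t+1)/(s+1))⌋`), i.e. `Ψ(t) ≤ θ^{(t+1)/(2s+2)}`.

Group-blind, no smallness beyond `0 ≤ θ`; nothing specific to weak coupling.  HONEST FRAMING: lemmas toward ONE stub of a
CONDITIONAL rung line; no mass-gap claim.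

Refs: Bradley, *Basic properties of strong mixing conditions* (2005) §1 (ρ-mixing); the percolation analogue is the
annulus-crossing / RSW doubling (Kesten 1982 Ch. 6).
-/

set_option autoImplicit false

noncomputable section

open Filter Topology MeasureTheory ProbabilityTheory
open Literature.MathematicalPhysics.QuantumFieldTheory Literature.MathematicalPhysics.QuantumLattice

namespace Summit.QuantumFields.YangMills.Cruxes.IR.ShellMaxCorr

/-! ## §3 Covariance bookkeeping for bounded observables -/

section Cov

variable {G : Type} [MeasurableSpace G] {N : ℕ}

/-- A bounded measurable real observable is in `L²` of any finite measure. -/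
theorem memLp_two_of_bdd (μ : Measure (GaugeConfig 4 N G)) [IsFiniteMeasure μ]
    {f : GaugeConfig 4 N G → ℝ} (hf : Measurable f) {C : ℝ} (hC : ∀ U, |f U| ≤ C) : MemLp f 2 μ :=
  MemLp.of_bound hf.aestronglyMeasurable C (ae_of_all _ fun U => by rw [Real.norm_eq_abs]; exact hC U)

/-- `Cov(f,g) = ∫ f g − ∫ f ∫ g` for bounded measurable observables on a probability space. -/
theorem cov_eq_integral (μ : Measure (GaugeConfig 4 N G)) [IsProbabilityMeasure μ]
    {f g : GaugeConfig 4 N G → ℝ} (hf : Measurable f) {Cf : ℝ} (hCf : ∀ U, |f U| ≤ Cf)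
    (hg : Measurable g) {Cg : ℝ} (hCg : ∀ U, |g U| ≤ Cg) :
    cov[f, g; μ] = (∫ U, f U * g U ∂μ) - (∫ U, f U ∂μ) * (∫ U, g U ∂μ) := by
  rw [covariance_eq_sub (memLp_two_of_bdd μ hf hCf) (memLp_two_of_bdd μ hg hCg)]
  rfl

/-- `Var f = Cov(f,f)`. -/
theorem variance_eq_cov (μ : Measure (GaugeConfig 4 N G)) {f : GaugeConfig 4 N G → ℝ} (hf : Measurable f) :
    Var[f; μ] = cov[f, f; μ] :=
  (covariance_self hf.aemeasurable).symm

end Cov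

/-! ## §4 The doubling law `Ψ(2s+1) ≤ Ψ(s)²` -/

section Doubling

variable {G : Type} [Group G] [TopologicalSpace G] [IsTopologicalGroup G] [CompactSpace G]
  [MeasurableSpace G] [BorelSpace G]

/-- **Doubling law** (annulus gluing: Markov layer + Hilbert-space product bound).  If the shell maximal correlation at
thickness `s` is `≤ θ` for every inner radius, then at thickness `2s+1` it is `≤ θ²` for every inner radius: with the
layer version `g'` of `g` across the sphere of radius `R+s+1`, `Cov(f,g) = Cov(f,g')`, `Var g' = Cov(g',g)`, and both
pairs `(f, g')`, `(g', g)` are `s`-separated. -/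
theorem shellCert_double [T2Space G] [SecondCountableTopology G] {n : ℕ}
    (ρ : G →* Matrix (Fin n) (Fin n) ℂ) (hρ : Continuous ρ) (β : ℝ) (S s : ℕ) {θ : ℝ} (hθ : 0 ≤ θ)
    (h : ShellCert ρ β S s θ) : ShellCert ρ β S (2 * s + 1) (θ ^ 2) := by
  intro R f g hfm hgm hfb hgb hf hg
  obtain ⟨Cf, hfC⟩ := hfb
  obtain ⟨Cg, hgC⟩ := hgb
  set μ : Measure (GaugeConfig 4 (2 * S + 1) G) := wilsonMeasure (d := 4) (L := 2 * S + 1) ρ β with hμ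
  haveI : IsProbabilityMeasure μ := isProbabilityMeasure_wilsonMeasure (d := 4) (L := 2 * S + 1) ρ hρ β
  -- the layer at radius `t = R + s + 1`
  have hgt : DependsOn g {e | OutBall (R + s + 1) e} :=
    hg.mono fun e he => outBall_anti (by omega) he
  obtain ⟨g', hg'm, hg'C, hg'dep, hswap⟩ :=
    exists_layer_version ρ hρ β (2 * S + 1) (R + s + 1) hgm hgC hgt
  have hg'in : DependsOn g' {e | InBall (R + s + 1) e} := hg'dep.mono fun e he => he.1
  have hg'out : DependsOn g' {e | OutBall (R + s) e} := hg'dep.mono fun e he => outBall_anti (by omega) he.2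
  -- the three integral identities
  have hfg : ∫ U, f U * g U ∂μ = ∫ U, f U * g' U ∂μ :=
    hswap f hfm ⟨Cf, hfC⟩ (hf.mono fun e he => inBall_mono (by omega) he)
  have h1g : ∫ U, g U ∂μ = ∫ U, g' U ∂μ := by
    have := hswap (fun _ => (1 : ℝ)) measurable_const ⟨1, fun _ => by simp⟩
      ((dependsOn_const (1 : ℝ)).mono (Set.empty_subset _))
    simpa only [one_mul] using this
  have hg'g : ∫ U, g' U * g U ∂μ = ∫ U, g' U * g' U ∂μ := hswap g' hg'm ⟨Cg, hg'C⟩ hg'in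
  -- covariances
  have hcov_fg : cov[f, g; μ] = cov[f, g'; μ] := by
    rw [cov_eq_integral μ hfm hfC hgm hgC, cov_eq_integral μ hfm hfC hg'm hg'C, hfg, h1g]
  have hvar_g' : Var[g'; μ] = cov[g', g; μ] := by
    rw [variance_eq_cov μ hg'm, cov_eq_integral μ hg'm hg'C hg'm hg'C, cov_eq_integral μ hg'm hg'C hgm hgC,
      hg'g, h1g]
  -- the two applications of the certificate
  have hA := h R f g' hfm hg'm ⟨Cf, hfC⟩ ⟨_, hg'C⟩ hf hg'out
  have hRs : R + s + 1 + s = R + (2 * s + 1) := by ring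
  have hB := h (R + s + 1) g' g hg'm hgm ⟨_, hg'C⟩ ⟨Cg, hgC⟩ hg'in (by rw [hRs]; exact hg)
  -- `σ(g') ≤ θ σ(g)`
  set a := Real.sqrt (Var[f; μ]) with ha
  set b := Real.sqrt (Var[g'; μ]) with hb
  set c := Real.sqrt (Var[g; μ]) with hc
  have hb0 : 0 ≤ b := Real.sqrt_nonneg _
  have hc0 : 0 ≤ c := Real.sqrt_nonneg _
  have ha0 : 0 ≤ a := Real.sqrt_nonneg _
  have hbb : b * b ≤ b * (θ * c) := by
    have hv : Var[g'; μ] = b * b := by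
      rw [hb, Real.mul_self_sqrt (variance_nonneg _ _)]
    have : |cov[g', g; μ]| = b * b := by rw [← hvar_g', abs_of_nonneg (variance_nonneg _ _), hv]
    calc b * b = |cov[g', g; μ]| := this.symm
      _ ≤ θ * b * c := hB
      _ = b * (θ * c) := by ring
  have hbθc : b ≤ θ * c := by
    rcases hb0.lt_or_eq with hpos | hzero
    · exact le_of_mul_le_mul_left hbb hpos
    · rw [← hzero]; exact mul_nonneg hθ hc0
  calc |cov[f, g; μ]| = |cov[f, g'; μ]| := by rw [hcov_fg]
    _ ≤ θ * a * b := hA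
    _ ≤ θ * a * (θ * c) := mul_le_mul_of_nonneg_left hbθc (mul_nonneg hθ ha0)
    _ = θ ^ 2 * a * c := by ring

end Doubling


/-! ## §5 Monotonicity and iteration of the doubling law -/

section Iterate

variable {G : Type} [Group G] [TopologicalSpace G] [IsTopologicalGroup G] [CompactSpace G]
  [MeasurableSpace G] [BorelSpace G]

/-- The shell bound is monotone in the thickness. -/
theorem shellCorrBound_mono_thickness {n : ℕ} {ρ : G →* Matrix (Fin n) (Fin n) ℂ} {β : ℝ} {N : ℕ} [NeZero N]
    {R s s' : ℕ} {θ : ℝ} (hss' : s ≤ s') (h : ShellCorrBound ρ β N R s θ) : ShellCorrBound ρ β N R s' θ :=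
  fun f g hfm hgm hfb hgb hf hg =>
    h f g hfm hgm hfb hgb hf (hg.mono fun _ he => outBall_anti (by omega) he)

/-- The shell bound is monotone in the constant. -/
theorem shellCorrBound_mono_const {n : ℕ} {ρ : G →* Matrix (Fin n) (Fin n) ℂ} {β : ℝ} {N : ℕ} [NeZero N]
    {R s : ℕ} {θ θ' : ℝ} (hθ : θ ≤ θ') (h : ShellCorrBound ρ β N R s θ) : ShellCorrBound ρ β N R s θ' :=
  fun f g hfm hgm hfb hgb hf hg =>
    (h f g hfm hgm hfb hgb hf hg).trans (by gcongr)

/-- The certificate is monotone in the thickness and the constant. -/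
theorem shellCert_mono {n : ℕ} {ρ : G →* Matrix (Fin n) (Fin n) ℂ} {β : ℝ} {S s s' : ℕ} {θ θ' : ℝ}
    (hss' : s ≤ s') (hθ : θ ≤ θ') (h : ShellCert ρ β S s θ) : ShellCert ρ β S s' θ' :=
  fun R => shellCorrBound_mono_const hθ (shellCorrBound_mono_thickness hss' (h R))

/-- **Iterated doubling**: from `Ψ(s) ≤ θ`, `Ψ(2^k (s+1) − 1) ≤ θ^(2^k)`. -/
theorem shellCert_iterate [T2Space G] [SecondCountableTopology G] {n : ℕ}
    (ρ : G →* Matrix (Fin n) (Fin n) ℂ) (hρ : Continuous ρ) (β : ℝ) (S s : ℕ) {θ : ℝ} (hθ : 0 ≤ θ)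
    (h : ShellCert ρ β S s θ) (k : ℕ) : ShellCert ρ β S (2 ^ k * (s + 1) - 1) (θ ^ (2 ^ k)) := by
  induction k with
  | zero => simpa using h
  | succ k ih =>
    have hd := shellCert_double ρ hρ β S (2 ^ k * (s + 1) - 1) (pow_nonneg hθ _) ih
    have h1 : 1 ≤ 2 ^ k * (s + 1) := Nat.one_le_iff_ne_zero.2 (by positivity)
    have hs : 2 * (2 ^ k * (s + 1) - 1) + 1 = 2 ^ (k + 1) * (s + 1) - 1 := by
      have h2 : 2 ^ (k + 1) * (s + 1) = 2 * (2 ^ k * (s + 1)) := by ring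
      rw [h2]; omega
    have hθ' : (θ ^ 2 ^ k) ^ 2 = θ ^ 2 ^ (k + 1) := by
      rw [← pow_mul, pow_succ]
    rw [hs, hθ'] at hd
    exact hd

/-- **Decay at every thickness beyond the certified one**: for `s ≤ t`, `Ψ(t) ≤ θ^(2^k)` with
`k = ⌊log₂ ((t+1)/(s+1))⌋`. -/
theorem shellCert_of_le [T2Space G] [SecondCountableTopology G] {n : ℕ}
    (ρ : G →* Matrix (Fin n) (Fin n) ℂ) (hρ : Continuous ρ) (β : ℝ) (S : ℕ) {s t : ℕ} {θ : ℝ} (hθ : 0 ≤ θ)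
    (h : ShellCert ρ β S s θ) (hst : s ≤ t) :
    ShellCert ρ β S t (θ ^ (2 ^ Nat.log 2 ((t + 1) / (s + 1)))) := by
  have hk := shellCert_iterate ρ hρ β S s hθ h (Nat.log 2 ((t + 1) / (s + 1)))
  refine shellCert_mono ?_ le_rfl hk
  have hm : (t + 1) / (s + 1) ≠ 0 := by
    rw [Ne, Nat.div_eq_zero_iff]; omega
  have h2 : 2 ^ Nat.log 2 ((t + 1) / (s + 1)) ≤ (t + 1) / (s + 1) := Nat.pow_log_le_self 2 hm
  have h3 : 2 ^ Nat.log 2 ((t + 1) / (s + 1)) * (s + 1) ≤ t + 1 :=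
    (Nat.mul_le_mul_right _ h2).trans (Nat.div_mul_le_self _ _)
  omega

/-- The exponent `2^⌊log₂((t+1)/(s+1))⌋` is at least `(t+1) / (2(s+1))`. -/
theorem div_le_two_pow_log (s t : ℕ) :
    ((t : ℝ) + 1) / (2 * ((s : ℝ) + 1)) ≤ (2 : ℝ) ^ Nat.log 2 ((t + 1) / (s + 1)) := by
  set m : ℕ := (t + 1) / (s + 1) with hm
  have hlt : m < 2 ^ (Nat.log 2 m + 1) := Nat.lt_pow_succ_log_self (by norm_num) m
  have ht : t + 1 < (s + 1) * (m + 1) := Nat.lt_mul_div_succ (t + 1) (Nat.succ_pos s)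
  have hm1 : (m : ℝ) + 1 ≤ 2 * (2 : ℝ) ^ Nat.log 2 m := by
    have h' : m + 1 ≤ 2 ^ (Nat.log 2 m + 1) := hlt
    calc (m : ℝ) + 1 = ((m + 1 : ℕ) : ℝ) := by push_cast; ring
      _ ≤ ((2 ^ (Nat.log 2 m + 1) : ℕ) : ℝ) := by exact_mod_cast h'
      _ = 2 * (2 : ℝ) ^ Nat.log 2 m := by push_cast; ring
  have h1 : (t : ℝ) + 1 ≤ ((s : ℝ) + 1) * (2 * (2 : ℝ) ^ Nat.log 2 m) := by
    calc (t : ℝ) + 1 = ((t + 1 : ℕ) : ℝ) := by push_cast; ring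
      _ ≤ (((s + 1) * (m + 1) : ℕ) : ℝ) := by exact_mod_cast ht.le
      _ = ((s : ℝ) + 1) * ((m : ℝ) + 1) := by push_cast; ring
      _ ≤ ((s : ℝ) + 1) * (2 * (2 : ℝ) ^ Nat.log 2 m) := by gcongr
  rw [div_le_iff₀ (by positivity)]
  calc (t : ℝ) + 1 ≤ ((s : ℝ) + 1) * (2 * (2 : ℝ) ^ Nat.log 2 m) := h1
    _ = (2 : ℝ) ^ Nat.log 2 m * (2 * ((s : ℝ) + 1)) := by ring

end Iterate

end Summit.QuantumFields.YangMills.Cruxes.IR.ShellMaxCorr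

end
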